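import Literature.NumberTheory.NumberFields.CubicField14483
import Literature.NumberTheory.NumberFields.CubicFieldResiduePrimes
import HarnessLib

/-!
# The cubic field of discriminant `-14483`, II: residue maps and the degree-one primes above
# `2, 3, 5, 7, 19, 23, 29, 2069`; all primes above `3`, `7`, `2069`

Second file on the `2`-division field `K = ℚ(γ)` of `E_{28/9}` (`CubicField14483.lean`: `γ³ - γ² + 27γ + 36 = 0`,
`δ = (γ² - γ + 18)/3`, `3 · 𝓞 K ⊆ ℤ[γ]`, `4 · 𝓞 K ⊆ ℤ[δ]`). With the generic kernel-prime API of
`CubicFieldResiduePrimes.lean` (Marcus, Ch. 3, Thm. 27 read through residue maps `𝓞 K → ℤ/p`):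

* §1 (generic, `MonicCubic`) `eq_span_of_polyMod_eq_mul₃` — if `f ≡ (X - r₁)(X - r₂)(X - r₃) (mod p)`,
  `p ∤ exponent(θ)`, then every prime above `p` is one of the `(p, θ - rᵢ)` (Dedekind–Kummer: an irreducible
  monic factor of a product of monic linears is one of them); `linear_of_dvd_linear`.
* §2 the residue maps of `K`: at a root `r` of `f mod p`, `p ≠ 3`, a ring map `ψ : 𝓞 K → ℤ/p` with `ψ(γ) = r`
  and `3ψ(δ) = r² - r + 18` (`exists_residueHom_gamma`); at `p = 3` through `δ`: maps with
  `(ψ(γ), ψ(δ)) = (1, 0), (0, 1), (0, 2)` (`exists_residueHom_three`). Their kernels are primes of norm `p`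
  above `p` (generic `ker_zmod_*`).
* §3 the bad primes of `E_{28/9}`: `f ≡ X(X² + X + 1) (mod 2)`, `(X - 1)²(X - 6) (mod 7)`,
  `(X - 1278)²(X - 1583) (mod 2069)`, `g ≡ X(X - 1)(X - 2) (mod 3)`: hence **every prime above `7` is
  `ker ψ₇,₁` or `ker ψ₇,₆`, every prime above `2069` is `ker ψ₂₀₆₉,₁₂₇₈` or `ker ψ₂₀₆₉,₁₅₈₃`, every prime
  above `3` is one of the three `ker ψ₃,ᵢ`** (`eq_ker_of_mem_primesOver_seven/_2069/_three`), and these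
  kernels are pairwise distinct.  (Above `2`: `ker ψ₂,₀` of norm `2` and one prime of residue degree `2`; the
  latter is not a kernel of a map to `ℤ/2` and is treated in the sequel.)

Everything is proved; theorems only. Numerics (seat bsd-line-spt-p1 g26): `2 = 𝔭₂𝔮₂`, `3 = 𝔭𝔭'𝔭''`,
`7 = 𝔭₇²𝔮₇`, `2069 = 𝔭²𝔮`; `Cl(K) ≅ ℤ/8 = ⟨[𝔭₂]⟩` (sequel).

## References
* [Marcus2018] D. A. Marcus, *Number Fields*, 2nd ed. (2018), Ch. 3, Thm. 27.
-/

noncomputable section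

open Polynomial Module NumberField Ideal
open scoped NumberField

namespace Literature.NumberTheory.NumberFields

namespace MonicCubic

variable {K : Type*} [Field K] [NumberField K] {a b c : ℤ} {θ : K}

/-! ### §1 Dedekind–Kummer when `f mod p` is a product of linear factors -/

/-- A monic polynomial of positive degree dividing a monic linear polynomial equals it. [cite: Marcus2018, Ch. 3, Thm. 27 (proof)] -/
theorem linear_of_dvd_linear {F : Type*} [Field F] {Q : F[X]} (hmon : Q.Monic) (hdeg : 0 < Q.natDegree)
    {r : F} (hdvd : Q ∣ X - C r) : Q = X - C r := by
  have hlin : (X - C r).Monic := monic_X_sub_C r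
  have hdeg1 : (X - C r).natDegree = 1 := natDegree_X_sub_C r
  have hle : Q.natDegree ≤ 1 := hdeg1 ▸ natDegree_le_of_dvd hdvd hlin.ne_zero
  obtain ⟨u, hu⟩ := hdvd
  have hu_mon : u.Monic := by
    have := hlin
    rw [hu] at this
    exact hmon.of_mul_monic_left this
  have hdeg_u : u.natDegree = 0 := by
    have h := congrArg natDegree hu
    rw [hdeg1, hmon.natDegree_mul hu_mon] at h
    omega
  rw [hu, Polynomial.eq_one_of_monic_natDegree_zero hu_mon hdeg_u, mul_one]


/-- `f mod p` as a product of three linear factors, from the elementary symmetric functions of the roots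
(Vieta). [cite: Marcus2018, Ch. 3, Thm. 27 (proof)] -/
theorem polyMod_eq_mul₃_of {p : ℕ} (r₁ r₂ r₃ : ZMod p)
    (h : (⟨1, (a : ZMod p), (b : ZMod p), (c : ZMod p)⟩ : Cubic (ZMod p)) =
      ⟨1, -(r₁ + r₂ + r₃), r₁ * r₂ + r₁ * r₃ + r₂ * r₃, -(r₁ * r₂ * r₃)⟩) :
    polyMod a b c p = (X - C r₁) * (X - C r₂) * (X - C r₃) := by
  rw [polyMod, poly_eq_toPoly, ← Cubic.map_toPoly, Cubic.prod_X_sub_C_eq, ← h]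
  simp [Cubic.map]

/-- **Dedekind–Kummer for a product of three linear factors**: if `f ≡ (X - r₁)(X - r₂)(X - r₃) (mod p)`
and `p ∤ exponent(θ)`, every prime of `𝓞 K` above `p` is `(p, θ - rᵢ)` for some `i`.
[cite: Marcus2018, Ch. 3, Thm. 27] -/
theorem eq_span_of_polyMod_eq_mul₃ (hirr : Irreducible (polyQ a b c)) (hθ : aeval θ (poly a b c) = 0)
    {p : ℕ} [hp : Fact p.Prime] (hexp : ¬ p ∣ RingOfIntegers.exponent (thetaInt hθ)) {r₁ r₂ r₃ : ℤ}
    (hsplit : polyMod a b c p = (X - C (r₁ : ZMod p)) * (X - C (r₂ : ZMod p)) * (X - C (r₃ : ZMod p)))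
    {P : Ideal (𝓞 K)} (hP : P ∈ primesOver (span {(p : ℤ)}) (𝓞 K)) :
    ∃ r : ℤ, (r = r₁ ∨ r = r₂ ∨ r = r₃) ∧ P = span {(p : 𝓞 K), thetaInt hθ - (r : 𝓞 K)} := by
  obtain ⟨Qb, hirr', hmon, hdvd, -, hspan⟩ := exists_factor_of_mem_primesOver' hirr hθ hp.out hexp hP
  have hprime : Prime Qb := hirr'.prime
  have hdeg : 0 < Qb.natDegree := hirr'.natDegree_pos
  rw [hsplit] at hdvd
  -- `Qb` divides one of the three linear factors, hence equals it
  have key : ∃ r : ℤ, (r = r₁ ∨ r = r₂ ∨ r = r₃) ∧ Qb = X - C (r : ZMod p) := by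
    rcases hprime.dvd_or_dvd hdvd with h12 | h3
    · rcases hprime.dvd_or_dvd h12 with h1 | h2
      · exact ⟨r₁, Or.inl rfl, linear_of_dvd_linear hmon hdeg h1⟩
      · exact ⟨r₂, Or.inr (Or.inl rfl), linear_of_dvd_linear hmon hdeg h2⟩
    · exact ⟨r₃, Or.inr (Or.inr rfl), linear_of_dvd_linear hmon hdeg h3⟩
  obtain ⟨r, hr, hQb⟩ := key
  refine ⟨r, hr, ?_⟩
  have h := hspan (X - C r) (by rw [hQb, Polynomial.map_sub, map_X, map_C, eq_intCast])
  simpa [map_sub, aeval_X, aeval_C] using h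

end MonicCubic

namespace CubicField14483

open MonicCubic

variable {K : Type*} [Field K] [NumberField K] {γ : K}

/-! ### §2 The residue maps of `K` -/

/-- **Residue map at a root of `f mod p`, `p ≠ 3`**: `ψ(γ) = r` and `3ψ(δ) = r² - r + 18`.
[cite: Marcus2018, Ch. 3, Thm. 27] -/
theorem exists_residueHom_gamma (hγ : γ ^ 3 - γ ^ 2 + 27 * γ + 36 = 0) (h3 : finrank ℚ K = 3)
    {p : ℕ} [hp : Fact p.Prime] (hp3 : p ≠ 3) (r : ℤ)
    (hr : (r : ZMod p) ^ 3 + ((-1 : ℤ) : ZMod p) * (r : ZMod p) ^ 2 + ((27 : ℤ) : ZMod p) * r +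
      ((36 : ℤ) : ZMod p) = 0) :
    ∃ ψ : 𝓞 K →+* ZMod p, ψ (thetaInt (aeval_eq hγ)) = r ∧
      3 * ψ (thetaInt (delta_root hγ)) = (r : ZMod p) ^ 2 - r + 18 := by
  have hpN : ¬ p ∣ 3 := fun h => hp3 ((Nat.prime_dvd_prime_iff_eq hp.out Nat.prime_three).mp h)
  obtain ⟨ψ, hψ⟩ := MonicCubic.exists_residueHom irreducible_polyQ (aeval_eq hγ) h3 (mem3 hγ h3) hpN r hr
  refine ⟨ψ, hψ, ?_⟩
  have h := congrArg ψ (three_delta hγ)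
  rw [map_mul, map_ofNat, map_add, map_sub, map_pow, map_ofNat, hψ] at h
  exact h

/-- **Residue maps at `3`** (through `δ`; `g ≡ X(X - 1)(X - 2) ≡ X³ - X (mod 3)` vanishes identically on `ℤ/3`):
for every `s` a ring map `ψ : 𝓞 K → ℤ/3` with `ψ(δ) = s` and `ψ(γ) = 1 - s²`, i.e.
`(ψ(γ), ψ(δ)) ∈ {(1,0), (0,1), (0,2)}` (from `δ² = 22 - 4γ + 3δ`). [cite: Marcus2018, Ch. 3, Thm. 27] -/
theorem exists_residueHom_three (hγ : γ ^ 3 - γ ^ 2 + 27 * γ + 36 = 0) (h3 : finrank ℚ K = 3)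
    (s : ℤ) :
    ∃ ψ : 𝓞 K →+* ZMod 3, ψ (thetaInt (delta_root hγ)) = s ∧
      ψ (thetaInt (aeval_eq hγ)) = 1 - (s : ZMod 3) ^ 2 := by
  -- finite facts in `ℤ/3`, decided before any local instance is in scope
  have hroots : ∀ t : ZMod 3, t ^ 3 + ((0 : ℤ) : ZMod 3) * t ^ 2 + ((-31 : ℤ) : ZMod 3) * t +
      ((-114 : ℤ) : ZMod 3) = 0 := by decide
  have h4 : (4 : ZMod 3) = 1 := by decide
  have h3' : (3 : ZMod 3) = 0 := by decide
  have h22 : (22 : ZMod 3) = 1 := by decide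
  haveI : Fact (Nat.Prime 3) := ⟨Nat.prime_three⟩
  obtain ⟨ψ, hψ⟩ := MonicCubic.exists_residueHom irreducible_polyQ_delta (delta_root hγ) h3 (mem4_delta hγ h3)
    (by norm_num) s (hroots _)
  refine ⟨ψ, hψ, ?_⟩
  -- `δ² = 22 - 4γ + 3δ` gives `ψ(γ) = 1 - s²` in `ℤ/3`
  have h := congrArg ψ (mul_table hγ).2.2
  rw [map_pow, map_add, map_sub, map_mul, map_mul, map_ofNat, map_ofNat, map_ofNat, hψ, h4, h3', h22,
    one_mul, zero_mul, add_zero] at h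
  linear_combination h

/-! ### §3 The bad primes: factorisation shapes modulo `2, 3, 7, 2069`; enumeration of the primes -/

/-- `f ≡ (X - 1)(X - 1)(X - 6) (mod 7)`. [cite: Marcus2018, Ch. 3, Thm. 27] -/
theorem polyMod_seven : polyMod (-1) 27 36 7 =
    (X - C ((1 : ℤ) : ZMod 7)) * (X - C ((1 : ℤ) : ZMod 7)) * (X - C ((6 : ℤ) : ZMod 7)) :=
  polyMod_eq_mul₃_of _ _ _ (by simp only [Cubic.mk.injEq]; decide)

/-- `f ≡ (X - 1278)(X - 1278)(X - 1583) (mod 2069)`. [cite: Marcus2018, Ch. 3, Thm. 27] -/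
theorem polyMod_2069 : polyMod (-1) 27 36 2069 =
    (X - C ((1278 : ℤ) : ZMod 2069)) * (X - C ((1278 : ℤ) : ZMod 2069)) * (X - C ((1583 : ℤ) : ZMod 2069)) :=
  polyMod_eq_mul₃_of _ _ _ (by simp only [Cubic.mk.injEq]; decide)

/-- `g ≡ X(X - 1)(X - 2) (mod 3)`. [cite: Marcus2018, Ch. 3, Thm. 27] -/
theorem polyMod_delta_three : polyMod 0 (-31) (-114) 3 =
    (X - C ((0 : ℤ) : ZMod 3)) * (X - C ((1 : ℤ) : ZMod 3)) * (X - C ((2 : ℤ) : ZMod 3)) :=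
  polyMod_eq_mul₃_of _ _ _ (by simp only [Cubic.mk.injEq]; decide)

/-- **The primes above `7`**: every prime of `𝓞 K` above `7` is `(7, γ - 1)` or `(7, γ - 6)`.
[cite: Marcus2018, Ch. 3, Thm. 27] -/
theorem eq_span_of_mem_primesOver_seven (hγ : γ ^ 3 - γ ^ 2 + 27 * γ + 36 = 0) (h3 : finrank ℚ K = 3)
    {P : Ideal (𝓞 K)} (hP : P ∈ primesOver (span {((7 : ℕ) : ℤ)}) (𝓞 K)) :
    P = span {((7 : ℕ) : 𝓞 K), thetaInt (aeval_eq hγ) - ((1 : ℤ) : 𝓞 K)} ∨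
      P = span {((7 : ℕ) : 𝓞 K), thetaInt (aeval_eq hγ) - ((6 : ℤ) : 𝓞 K)} := by
  haveI : Fact (Nat.Prime 7) := ⟨by norm_num⟩
  obtain ⟨r, hr, hPr⟩ := eq_span_of_polyMod_eq_mul₃ irreducible_polyQ (aeval_eq hγ)
    (not_dvd_exponent hγ h3 (by norm_num) (by norm_num)) polyMod_seven hP
  rcases hr with rfl | rfl | rfl
  · exact Or.inl hPr
  · exact Or.inl hPr
  · exact Or.inr hPr

/-- **The primes above `2069`**: every prime of `𝓞 K` above `2069` is `(2069, γ - 1278)` or `(2069, γ - 1583)`.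
[cite: Marcus2018, Ch. 3, Thm. 27] -/
theorem eq_span_of_mem_primesOver_2069 (hγ : γ ^ 3 - γ ^ 2 + 27 * γ + 36 = 0) (h3 : finrank ℚ K = 3)
    {P : Ideal (𝓞 K)} (hP : P ∈ primesOver (span {((2069 : ℕ) : ℤ)}) (𝓞 K)) :
    P = span {((2069 : ℕ) : 𝓞 K), thetaInt (aeval_eq hγ) - ((1278 : ℤ) : 𝓞 K)} ∨
      P = span {((2069 : ℕ) : 𝓞 K), thetaInt (aeval_eq hγ) - ((1583 : ℤ) : 𝓞 K)} := by
  haveI : Fact (Nat.Prime 2069) := ⟨by norm_num⟩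
  obtain ⟨r, hr, hPr⟩ := eq_span_of_polyMod_eq_mul₃ irreducible_polyQ (aeval_eq hγ)
    (not_dvd_exponent hγ h3 (by norm_num) (by norm_num)) polyMod_2069 hP
  rcases hr with rfl | rfl | rfl
  · exact Or.inl hPr
  · exact Or.inl hPr
  · exact Or.inr hPr

/-- **The primes above `3`** (through `δ`): every prime of `𝓞 K` above `3` is `(3, δ)`, `(3, δ - 1)` or
`(3, δ - 2)`. [cite: Marcus2018, Ch. 3, Thm. 27] -/
theorem eq_span_of_mem_primesOver_three (hγ : γ ^ 3 - γ ^ 2 + 27 * γ + 36 = 0) (h3 : finrank ℚ K = 3)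
    {P : Ideal (𝓞 K)} (hP : P ∈ primesOver (span {((3 : ℕ) : ℤ)}) (𝓞 K)) :
    ∃ s : ℤ, (s = 0 ∨ s = 1 ∨ s = 2) ∧ P = span {((3 : ℕ) : 𝓞 K), thetaInt (delta_root hγ) - (s : 𝓞 K)} := by
  haveI : Fact (Nat.Prime 3) := ⟨Nat.prime_three⟩
  exact eq_span_of_polyMod_eq_mul₃ irreducible_polyQ_delta (delta_root hγ)
    (not_dvd_exponent_delta hγ h3 Nat.prime_three (by norm_num)) polyMod_delta_three hP

/-- **The primes above `7`, as kernels**: if `ψ₁, ψ₆ : 𝓞 K → ℤ/7` are residue maps with `ψ₁(γ) = 1`,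
`ψ₆(γ) = 6`, then `ker ψ₁ ≠ ker ψ₆` and every prime above `7` is one of them (so `7 𝓞 K = (ker ψ₁)² · ker ψ₆`
by degree count, not proved here). [cite: Marcus2018, Ch. 3, Thm. 27] -/
theorem eq_ker_of_mem_primesOver_seven (hγ : γ ^ 3 - γ ^ 2 + 27 * γ + 36 = 0) (h3 : finrank ℚ K = 3)
    (ψ₁ ψ₆ : 𝓞 K →+* ZMod 7) (h₁ : ψ₁ (thetaInt (aeval_eq hγ)) = ((1 : ℤ) : ZMod 7))
    (h₆ : ψ₆ (thetaInt (aeval_eq hγ)) = ((6 : ℤ) : ZMod 7))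
    {P : Ideal (𝓞 K)} (hP : P ∈ primesOver (span {((7 : ℕ) : ℤ)}) (𝓞 K)) :
    RingHom.ker ψ₁ ≠ RingHom.ker ψ₆ ∧ (P = RingHom.ker ψ₁ ∨ P = RingHom.ker ψ₆) := by
  have ne : ((6 : ℤ) : ZMod 7) ≠ ((1 : ℤ) : ZMod 7) := by decide
  haveI : Fact (Nat.Prime 7) := ⟨by norm_num⟩
  have hexp := not_dvd_exponent hγ h3 (p := 7) (by norm_num) (by norm_num)
  refine ⟨ker_ne_ker_of_apply_ne ψ₁ ψ₆ h₁ (by rw [h₆]; exact ne) rfl, ?_⟩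
  rw [ker_residueHom_eq_span irreducible_polyQ (aeval_eq hγ) hexp ψ₁ h₁,
    ker_residueHom_eq_span irreducible_polyQ (aeval_eq hγ) hexp ψ₆ h₆]
  exact eq_span_of_mem_primesOver_seven hγ h3 hP

/-- **The primes above `2069`, as kernels** (`ψ(γ) = 1278`, `ψ'(γ) = 1583`). [cite: Marcus2018, Ch. 3, Thm. 27] -/
theorem eq_ker_of_mem_primesOver_2069 (hγ : γ ^ 3 - γ ^ 2 + 27 * γ + 36 = 0) (h3 : finrank ℚ K = 3)
    (ψ ψ' : 𝓞 K →+* ZMod 2069) (h₁ : ψ (thetaInt (aeval_eq hγ)) = ((1278 : ℤ) : ZMod 2069))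
    (h₂ : ψ' (thetaInt (aeval_eq hγ)) = ((1583 : ℤ) : ZMod 2069))
    {P : Ideal (𝓞 K)} (hP : P ∈ primesOver (span {((2069 : ℕ) : ℤ)}) (𝓞 K)) :
    RingHom.ker ψ ≠ RingHom.ker ψ' ∧ (P = RingHom.ker ψ ∨ P = RingHom.ker ψ') := by
  have ne : ((1583 : ℤ) : ZMod 2069) ≠ ((1278 : ℤ) : ZMod 2069) := by decide
  haveI : Fact (Nat.Prime 2069) := ⟨by norm_num⟩
  have hexp := not_dvd_exponent hγ h3 (p := 2069) (by norm_num) (by norm_num)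
  refine ⟨ker_ne_ker_of_apply_ne ψ ψ' h₁ (by rw [h₂]; exact ne) rfl, ?_⟩
  rw [ker_residueHom_eq_span irreducible_polyQ (aeval_eq hγ) hexp ψ h₁,
    ker_residueHom_eq_span irreducible_polyQ (aeval_eq hγ) hexp ψ' h₂]
  exact eq_span_of_mem_primesOver_2069 hγ h3 hP

/-- **The primes above `3`, as kernels** (`ψₛ(δ) = s`, `s = 0, 1, 2`): pairwise distinct, and every prime above
`3` is one of them (`3` splits completely). [cite: Marcus2018, Ch. 3, Thm. 27] -/
theorem eq_ker_of_mem_primesOver_three (hγ : γ ^ 3 - γ ^ 2 + 27 * γ + 36 = 0) (h3 : finrank ℚ K = 3)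
    (ψ₀ ψ₁ ψ₂ : 𝓞 K →+* ZMod 3) (h₀ : ψ₀ (thetaInt (delta_root hγ)) = ((0 : ℤ) : ZMod 3))
    (h₁ : ψ₁ (thetaInt (delta_root hγ)) = ((1 : ℤ) : ZMod 3))
    (h₂ : ψ₂ (thetaInt (delta_root hγ)) = ((2 : ℤ) : ZMod 3))
    {P : Ideal (𝓞 K)} (hP : P ∈ primesOver (span {((3 : ℕ) : ℤ)}) (𝓞 K)) :
    (RingHom.ker ψ₀ ≠ RingHom.ker ψ₁ ∧ RingHom.ker ψ₀ ≠ RingHom.ker ψ₂ ∧ RingHom.ker ψ₁ ≠ RingHom.ker ψ₂) ∧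
      (P = RingHom.ker ψ₀ ∨ P = RingHom.ker ψ₁ ∨ P = RingHom.ker ψ₂) := by
  have ne01 : ((1 : ℤ) : ZMod 3) ≠ ((0 : ℤ) : ZMod 3) := by decide
  have ne02 : ((2 : ℤ) : ZMod 3) ≠ ((0 : ℤ) : ZMod 3) := by decide
  have ne12 : ((2 : ℤ) : ZMod 3) ≠ ((1 : ℤ) : ZMod 3) := by decide
  haveI : Fact (Nat.Prime 3) := ⟨Nat.prime_three⟩
  have hexp := not_dvd_exponent_delta hγ h3 Nat.prime_three (by norm_num)
  refine ⟨⟨ker_ne_ker_of_apply_ne ψ₀ ψ₁ h₀ (by rw [h₁]; exact ne01) rfl,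
    ker_ne_ker_of_apply_ne ψ₀ ψ₂ h₀ (by rw [h₂]; exact ne02) rfl,
    ker_ne_ker_of_apply_ne ψ₁ ψ₂ h₁ (by rw [h₂]; exact ne12) rfl⟩, ?_⟩
  rw [ker_residueHom_eq_span irreducible_polyQ_delta (delta_root hγ) hexp ψ₀ h₀,
    ker_residueHom_eq_span irreducible_polyQ_delta (delta_root hγ) hexp ψ₁ h₁,
    ker_residueHom_eq_span irreducible_polyQ_delta (delta_root hγ) hexp ψ₂ h₂]
  obtain ⟨s, hs, hPs⟩ := eq_span_of_mem_primesOver_three hγ h3 hP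
  rcases hs with rfl | rfl | rfl
  · exact Or.inl hPs
  · exact Or.inr (Or.inl hPs)
  · exact Or.inr (Or.inr hPs)

end CubicField14483

end Literature.NumberTheory.NumberFields

end
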